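import Literature.AnabelianGeometry.AbsoluteAnabelian.AbsCuspSeparated
import Literature.AnabelianGeometry.AbsoluteAnabelian.AbsCuspFactsSchemaRefutations
import Literature.AnabelianGeometry.AbsoluteAnabelian.GaloisSectionsFactsThm13iiSchema
import Literature.AnabelianGeometry.AbsoluteAnabelian.GaloisSectionsFactsSchemaNegative
import Literature.AnabelianGeometry.AbsoluteAnabelian.MLFGaloisTypeProofs
import HarnessLib

/-!
# The ten `CurveModel`-relative named facts of [AbsTopIII] §1 / [GalSect] / [AbsCusp] are JOINTLY
# satisfiable, non-vacuously, at ONE interface (instance-form side of ten schema rows)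

S. Mochizuki, *Topics in Absolute Anabelian Geometry III*, §1, Prop. 1.4 (i), (ii) p. 31, Rmk. 1.9.2 p. 38
[MochizukiAbsTopIII2015]; *Galois sections in absolute anabelian geometry* (2005) [MochizukiGalSect2005],
Thm. 1.3 (ii) p. 6, Lem. 3.1 p. 13, Cor. 3.2 p. 14; *Absolute anabelian cuspidalizations of proper
hyperbolic curves* (2007) [MochizukiAbsCusp2007], Prop. 1.6 (iii) p. 15, Thm. 2.1 (i) p. 42, Prop. 2.2 (ii)
p. 39.  Cell abc-iut, block F (fact-proving wave), seat abc-iut-f-056 (gen 2); PROOF-ONLY companion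
(no definition, no instance, no `Prop` fact) of `AbsTopIII/CurveModel.lean`, `CuspidalizationFactsModel.lean`
and `AbsCuspSeparated.lean` (imported, never edited).

THE ROWS.  The tree types these ten printed statements as NAMED FACTS RELATIVE TO an interface
`M : AbsTopIII.CurveModel` — the assignment "curve ↦ `1 → Δ → Π → G_k → 1`, cusps, closed points,
decomposition groups, cuspidal quotients" that an étale fundamental group functor WOULD provide (not
constructed in the tree, abc-iut plan/FOUNDATIONS.md row 12): `CurveModel.Prop_1_4_i` (F-0339),
`CurveModel.Prop_1_4_i'` (F-0340), `CurveModel.Prop_1_4_ii` (F-0341), `CurveModel.Rmk_1_9_2` (F-0236),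
`GalSect.Thm_1_3_ii_model` (F-0084), `GalSect.Lem_3_1_model` (F-0083), `GalSect.Cor_3_2_model` (F-0082),
`AbsCusp.Prop_1_6_iii_model` (F-0045), `AbsCusp.Thm_2_1_i_model` (F-0046; instantiated form
`AbsCusp.Thm_2_1_i_model_sep`), `AbsCusp.Prop_2_2_ii_model` (F-0044).  Sibling seats showed that the
UNIVERSAL CLOSURE of every one of them over ALL interfaces `M` is false (`CurveModelSchemaRefutations`,
`CurveModelSchemaWitnesses`, `CuspidalizationFactsModelProofs`, `GaloisSectionsFactsSchemaNegative`,
`AbsCuspFactsSchemaRefutations`, `AbsCuspSeparatedProofs`): the rows are consumable only AT A NAMED `M`,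
as hypotheses `(h : … M …)` — which is how the [AbsTopIII] Cor. 1.10 (iii)(f) chain consumes them
(e.g. `AbsCusp.thm_2_1_i_of_prop_2_2_ii`, binders `h22`, `h21`).

THIS FILE records the complementary kernel object, the POSITIVE instance-form side: the ten hypotheses are
JOINTLY SATISFIABLE at ONE interface, and NON-VACUOUSLY — at a curve of that interface carrying every flag
the rows' binders ask for (proper, scheme-like, base field an MLF, a closed point flagged NF, no cusps,
cofinite-open in itself with surjective restriction, a Galois section, a characteristic tower).  So no
consumer binding the package `(M) (hclosed) (h22 : Prop_2_2_ii_model M) (h21 : Thm_2_1_i_model_sep M hclosed)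
(h16 : Prop_1_6_iii_model M) (h13 : Thm_1_3_ii_model M hclosed) (h31 : Lem_3_1_model M P hclosed)
(h32 : Cor_3_2_model M P Q hclosed) (M.Prop_1_4_i) (M.Prop_1_4_i') (M.Prop_1_4_ii) (M.Rmk_1_9_2)` argues from
contradictory premises, and none of the ten rows is refutable outright (only their closures are).

* `CurveModel.facts_of_decomp_eq_top` — a DEGENERACY CRITERION, for an ARBITRARY interface `M`: if every
  decomposition group of a closed point is all of `Π`, every curve has exactly one closed point and it
  carries the NF flag, no curve has cusps, every augmentation `Π → G` is injective (`Δ = 1`) and every restriction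
  map `M.res` is bijective on `Π` and on `G`, then ALL TEN facts hold at `M` (for every value of the
  curve-predicate parameters of Lem. 3.1 / Cor. 3.2 and of the `Σ`-separatedness parameter of Thm. 2.1 (i)).
  It documents exactly which degenerate features make the package trivially true, i.e. what the rows'
  content is beyond the interface.
* `CurveModel.exists_facts_nonVacuous` — for every prime `p` the interface with ONE curve over `ℚ_p`,
  `Π = G_{ℚ_p} = G` (identity augmentation), no cusps, ONE closed point with `D = Π` flagged NF,
  `IsCofiniteOpen X X` with `res = 𝟙`, meets the criterion and every binder fires (`isMLF_padic`).
* Glue of independent use: `AbsCusp.thm_2_1_i_of_injective` (the Thm. 2.1 (i) predicate holds for ANY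
  `α` when both cuspidalization maps `Π_{U_S} ↠ Π_X`, `Π_{V_T} ↠ Π_Y` are injective, i.e. `S = T = ∅`),
  `AbsCusp.prop_1_6_iii_of_injective_of_isEmpty`, `AbsCusp.isSeparated_of_forall_eq_top`,
  `GalSect.cor_3_2_of_decomp_eq_top`, `GalSect.lem_3_1_i_iff_iv_of_decomp_eq_top`.

HONEST LABEL: DEGENERATE (`Δ = 1`, one point with `D = Π`, no cusps, `U_S = X`) — a joint-satisfiability
witness about OUR typing of the interface, not a model of any hyperbolic curve (for a proper hyperbolic
curve `Δ ≠ 1`); the printed content of the ten rows (étale `π₁`, Kummer theory of the Jacobian, [Tama]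
Cor. 2.10, [pGC] Thm. A …) is untouched and stays a named input at the intended instance.  FACT-LIST
vocabulary: instance forms «model-witnessed (toy)» for the ten rows; nothing is «proved».  Refereed
results typed statements-first (D-0014); typed ≠ proved; nothing here bears on the disputed [IUTchIII]
Cor. 3.12; no side taken.
-/

noncomputable section

open scoped Classical Pointwise

namespace Literature.AnabelianGeometry.AbsoluteAnabelian

open AbsTopIII CategoryTheory

universe u

/-! ### Glue: instance forms of the shape-(1) predicates at degenerate data -/

namespace AbsCusp

variable {E F : FundamentalExtension.{u}}

/-- The induced map `Π^{c-ab}_U → Π` on a class `[x]` is `proj x`.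
[cite: MochizukiAbsCusp2007, Thm 1.1 (iii) p.27] -/
theorem CuspidalizationData.projAb_mk {P : Type u} [Group P] [TopologicalSpace P] [T1Space P]
    (D : CuspidalizationData P) (x : D.grp) : D.projAb (QuotientGroup.mk x) = D.proj x :=
  rfl

/-- If the cuspidalization map `Π_U ↠ Π` is injective (no cusps removed, `U = X`), the induced map
`Π^{c-ab}_U → Π` is bijective (`I = 1`, so `[I, I]⁻ = 1`). [cite: MochizukiAbsCusp2007, Thm 1.1 (iii) p.27] -/
theorem CuspidalizationData.projAb_bijective_of_injective {P : Type u} [Group P] [TopologicalSpace P]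
    [T1Space P] (D : CuspidalizationData P) (h : Function.Injective D.proj) :
    Function.Bijective D.projAb := by
  refine ⟨fun a b hab => ?_, fun y => ?_⟩
  · induction a using QuotientGroup.induction_on with
    | H a =>
      induction b using QuotientGroup.induction_on with
      | H b =>
        rw [projAb_mk, projAb_mk] at hab
        rw [h hab]
  · obtain ⟨x, rfl⟩ := D.proj_surjective y
    exact ⟨QuotientGroup.mk x, D.projAb_mk x⟩

/-- **Thm. 2.1 (i) predicate, degenerate instance `S = T = ∅`.**  If both cuspidalization maps
`Π_{U_S} ↠ Π_X`, `Π_{V_T} ↠ Π_Y` are injective (hence isomorphisms), then for EVERY `α : Π_X ⥲ Π_Y` the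
maximal cuspidally abelian quotients are identified over `α` (`β := (Π^{c-ab}_{V_T} ≅ Π_Y)⁻¹ ∘ α ∘
(Π^{c-ab}_{U_S} ≅ Π_X)`).  Consistency of the typing only. [cite: MochizukiAbsCusp2007, Thm 2.1 (i) p.42] -/
theorem thm_2_1_i_of_injective (DS : CuspidalizationData E.arith) (DT : CuspidalizationData F.arith)
    (hS : Function.Injective DS.proj) (hT : Function.Injective DT.proj) (α : E.arith ≃ₜ* F.arith) :
    Thm_2_1_i DS DT α := by
  let eS : DS.MaxCuspAbelian ≃* E.arith :=
    MulEquiv.ofBijective DS.projAb (DS.projAb_bijective_of_injective hS)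
  let eT : DT.MaxCuspAbelian ≃* F.arith :=
    MulEquiv.ofBijective DT.projAb (DT.projAb_bijective_of_injective hT)
  refine ⟨eS.trans (α.toMulEquiv.trans eT.symm), fun z => ?_⟩
  show eT (eT.symm (α (eS z))) = α (eS z)
  exact eT.apply_symm_apply _

/-- **Prop. 1.6 (iii) predicate, degenerate instance `S = ∅` over an INJECTIVE (hence bijective)
cuspidal quotient `q`**: `N = Ker(q) ∩ Δ = 1`, `[N, Δ]⁻ = 1`, and the clauses on the (absent) inertia
groups are vacuous.  (Generalises `prop_1_6_iii_id_of_isEmpty`, the case `q = 𝟙`.)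
[cite: MochizukiAbsCusp2007, Prop 1.6 (iii) p.15] -/
theorem prop_1_6_iii_of_injective_of_isEmpty (q : E ⟶ F) (hinj : Function.Injective q.arith)
    (hsurj : Function.Surjective q.arith) {S : Type u} [IsEmpty S] (I : S → Subgroup E.arith) :
    Prop_1_6_iii q I := by
  have hN : q.arith.toMonoidHom.ker ⊓ E.geom = ⊥ := by
    rw [(MonoidHom.ker_eq_bot_iff _).mpr hinj, bot_inf_eq]
  refine ⟨hsurj, fun x => isEmptyElim x, ?_, fun x => isEmptyElim x⟩
  rw [hN, Subgroup.commutator_bot_left, topologicalClosure_bot, iSup_of_empty, bot_sup_eq]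

/-- Conjugation fixes the full subgroup `Π`. [folklore] -/
private theorem conj_smul_top (g : E.arith) : MulAut.conj g • (⊤ : Subgroup E.arith) = ⊤ :=
  eq_top_iff.mpr fun x _ => by
    rw [Subgroup.mem_pointwise_smul_iff_inv_smul_mem]
    exact Subgroup.mem_top _

/-- **Def. 1.5 (i) predicate (`Σ`-separated), degenerate instance**: a family of decomposition groups
indexed by AT MOST ONE point, all equal to `Π`, is separated — over a single point `x` with `D_x = Π`
every covering `X_H → X` has exactly one point over `x` (`H \ Π / Π` is a singleton).
[cite: MochizukiAbsCusp2007, Def 1.5 (i) p.31] -/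
theorem isSeparated_of_forall_eq_top {ι : Type*} (D : ι → Subgroup E.arith) (hι : ∀ i j : ι, i = j)
    (hD : ∀ i, D i = ⊤) : IsSeparated D := by
  intro H _ i j g g' _
  refine ⟨hι i j, 1, H.one_mem, g⁻¹ * g', ?_, ?_⟩
  · rw [hD i]
    exact Subgroup.mem_top _
  · rw [one_mul, mul_inv_cancel_left]

end AbsCusp

namespace GalSect

variable {E F : FundamentalExtension.{u}}

/-- Point data all of whose decomposition groups are `Π` (and with at least one point) have
`{D_x}` = `{Π}` as their set of decomposition groups. [cite: MochizukiGalSect2005, §1 p.6] -/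
theorem decompositionGroups_eq_of_decomp_eq_top (P : PointData E) [Nonempty P.Point]
    (hP : ∀ x, P.decomp x = ⊤) : P.decompositionGroups = {⊤} := by
  ext D
  simp only [PointData.decompositionGroups, Set.mem_setOf_eq, Set.mem_singleton_iff]
  constructor
  · rintro ⟨x, g, rfl⟩
    rw [hP x, AbsCusp.conj_smul_top]
  · rintro rfl
    obtain ⟨x⟩ := ‹Nonempty P.Point›
    exact ⟨x, 1, by rw [hP x, map_one, one_smul]⟩

/-- **Cor. 3.2 predicate, degenerate instance**: if on both sides every decomposition group is `Π`
(and both curves have a closed point), every `α : Π_{X_K} ⥲ Π_{Y_L}` carries `{Π_{X_K}}` onto `{Π_{Y_L}}`.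
[cite: MochizukiGalSect2005, Cor 3.2 p.14] -/
theorem cor_3_2_of_decomp_eq_top (P : PointData E) (Q : PointData F) [Nonempty P.Point]
    [Nonempty Q.Point] (hP : ∀ x, P.decomp x = ⊤) (hQ : ∀ y, Q.decomp y = ⊤) : Cor_3_2 P Q := by
  intro α
  rw [decompositionGroups_eq_of_decomp_eq_top P hP, decompositionGroups_eq_of_decomp_eq_top Q hQ,
    Set.image_singleton, Subgroup.map_top_of_surjective _ α.toMulEquiv.surjective]

/-- `Π` surjects onto `G`. [cite: MochizukiGalSect2005, Lem 3.1 (iv) p.13] -/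
theorem surjectsOntoGal_top (E : FundamentalExtension.{u}) : SurjectsOntoGal (⊤ : Subgroup E.arith) := by
  intro g _
  obtain ⟨y, hy⟩ := E.aug_surjective g
  exact ⟨y, Subgroup.mem_top y, hy⟩

/-- Over an extension with INJECTIVE augmentation (`Δ = 1`) every section `σ` of `Π ↠ G` is
surjective: `Im(σ) = Π`. [cite: MochizukiGalSect2005, §3 p.13] -/
theorem range_eq_top_of_aug_injective (haug : Function.Injective E.aug) (σ : E.gal →ₜ* E.arith)
    (hσ : ∀ g, E.aug (σ g) = g) : σ.toMonoidHom.range = ⊤ :=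
  eq_top_iff.mpr fun y _ => ⟨E.aug y, haug (hσ (E.aug y))⟩

/-- **Lem. 3.1 (i) ⇔ (iv) predicate, degenerate instance**: if `Δ = 1` (injective augmentation), every
decomposition group is `Π`, there is a closed point and every point is flagged algebraic, then for every
tower and every section both (i) (`Im(σ) = Π = D_x`) and (iv) (`D_x = Π ⊆ Π[j, σ]`, `D_x ↠ G`) hold, so
the equivalence holds. [cite: MochizukiGalSect2005, Lem 3.1 p.13] -/
theorem lem_3_1_i_iff_iv_of_decomp_eq_top (C : E.CuspidalData) (P : PointData E) [Nonempty P.Point]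
    (hP : ∀ x, P.decomp x = ⊤) (halg : ∀ x, P.IsAlgebraic x) (haug : Function.Injective E.aug) :
    Lem_3_1_i_iff_iv C P := by
  intro Δj _ σ hσ _
  obtain ⟨x⟩ := ‹Nonempty P.Point›
  have hrange := range_eq_top_of_aug_injective haug σ hσ
  refine iff_of_true ⟨x, 1, ?_⟩ fun j => ⟨x, 1, halg x, ?_, ?_⟩
  · rw [hrange, hP x, map_one, one_smul]
  · rw [hP x, map_one, one_smul, ← hrange]
    exact range_le_sectionNeighbourhood σ Δj j
  · rw [hP x, map_one, one_smul]
    exact surjectsOntoGal_top E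

/-- Over an extension with injective augmentation, `Δ = 1`. [cite: MochizukiAbsTopIII2015, Thm 1.9 p.37] -/
theorem geom_eq_bot_of_aug_injective (haug : Function.Injective E.aug) : E.geom = ⊥ :=
  (MonoidHom.ker_eq_bot_iff _).mpr haug

/-- Over an extension with `Δ = 1` the constant tower `Δ_X[j] := 1` is a characteristic tower (open
because `Δ` is a one-point space). [cite: MochizukiGalSect2005, §3 p.13] -/
theorem isCharacteristicTower_bot_of_aug_injective (haug : Function.Injective E.aug) :
    IsCharacteristicTower E fun _ => ⊥ := by
  have hsub : Subsingleton E.geom :=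
    ⟨fun a b => Subtype.ext (haug ((E.mem_geom.mp a.2).trans (E.mem_geom.mp b.2).symm))⟩
  refine ⟨fun _ _ _ => le_rfl, fun _ => ?_, fun _ φ => Subgroup.map_bot _, iInf_const⟩
  have huniv : ((⊥ : Subgroup E.geom) : Set E.geom) = Set.univ :=
    Set.eq_univ_of_forall fun z => (Subgroup.mem_bot).mpr (Subsingleton.elim z 1)
  rw [huniv]
  exact isOpen_univ

end GalSect

/-! ### The degeneracy criterion: all ten facts at once -/

namespace AbsTopIII.CurveModel

/-- **DEGENERACY CRITERION for the ten `CurveModel`-relative named facts** ([AbsTopIII] Prop. 1.4 (i)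
both clauses, Prop. 1.4 (ii), Rmk. 1.9.2; [GalSect] Thm. 1.3 (ii), Lem. 3.1, Cor. 3.2; [AbsCusp] Prop. 1.6
(iii), Thm. 2.1 (i) — for every value of its `Σ`-separatedness parameter, in particular the real one
`IsSeparatedCurve M` —, Prop. 2.2 (ii)).  At an interface `M` in which every decomposition group of a
closed point is `Π`, every curve has exactly one closed point and it carries the NF flag, no curve has
a cusp, every augmentation `Π → G` is injective (`Δ = 1`), and every restriction `Π_U → Π_{U'}` is
bijective on `Π` and on `G`, ALL TEN typed facts hold.  (Which is to say: their content lies entirely in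
what the intended étale-`π₁` instance does to these data; consistency of the typing only.)
[cite: MochizukiAbsTopIII2015, Prop 1.4 p.31] -/
theorem facts_of_decomp_eq_top (M : CurveModel.{u})
    (hclosed : ∀ (U : M.Curve) (x : M.Point U), IsClosed (M.decomp U x : Set (M.ext U).arith))
    (hdecomp : ∀ (U : M.Curve) (x : M.Point U), M.decomp U x = ⊤)
    (hpt : ∀ U : M.Curve, Nonempty (M.Point U)) (hone : ∀ (U : M.Curve) (x y : M.Point U), x = y)
    (halg : ∀ (U : M.Curve) (x : M.Point U), M.IsNFPoint U x)
    (hcusp : ∀ U : M.Curve, IsEmpty (M.cusps U).Cusp)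
    (haug : ∀ U : M.Curve, Function.Injective (M.ext U).aug)
    (hinj : ∀ (U U' : M.Curve) (h : M.IsCofiniteOpen U U'), Function.Injective (M.res h).arith)
    (hsurj : ∀ (U U' : M.Curve) (h : M.IsCofiniteOpen U U'), Function.Surjective (M.res h).arith)
    (hgal : ∀ (U U' : M.Curve) (h : M.IsCofiniteOpen U U'), Function.Bijective (M.res h).gal) :
    M.Prop_1_4_i ∧ M.Prop_1_4_i' ∧ M.Prop_1_4_ii ∧ M.Rmk_1_9_2 ∧
      GalSect.Thm_1_3_ii_model M hclosed ∧
      (∀ IsDefinedOverNF : M.Curve → Prop, GalSect.Lem_3_1_model M IsDefinedOverNF hclosed) ∧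
      (∀ IsDefinedOverNF IsIsogenousToGenusZero : M.Curve → Prop,
          GalSect.Cor_3_2_model M IsDefinedOverNF IsIsogenousToGenusZero hclosed) ∧
      AbsCusp.Prop_1_6_iii_model M ∧
      (∀ IsSep : M.Curve → Prop, AbsCusp.Thm_2_1_i_model M IsSep hclosed) ∧
      AbsCusp.Thm_2_1_i_model_sep M hclosed ∧
      AbsCusp.Prop_2_2_ii_model M := by
  haveI := hcusp
  haveI := hpt
  have h21 : ∀ IsSep : M.Curve → Prop, AbsCusp.Thm_2_1_i_model M IsSep hclosed :=
    fun _ US X VT Y hX hY hsX hsY _ _ _ _ _ _ α _ _ _ =>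
      AbsCusp.thm_2_1_i_of_injective _ _ (hinj US X hX) (hinj VT Y hY) α
  refine ⟨fun U _ c => isEmptyElim c, fun U U' h _ _ => ⟨hsurj U U' h, hgal U U' h, ∅, ?_⟩,
    fun Ux X h _ _ _ c => isEmptyElim c, fun X Y _ e => ?_, fun U _ => ⟨?_, ?_⟩,
    fun P U _ _ => ?_, fun P Q U V _ _ _ _ _ _ => ?_, fun US X h _ _ _ => ?_, h21,
    h21 (AbsCusp.IsSeparatedCurve M), fun X _ _ _ => ?_⟩
  · -- Prop. 1.4 (i), second clause: `Ker(res) = 1` is the closed normal closure of no inertia group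
    rw [(MonoidHom.ker_eq_bot_iff _).mpr (hinj U U' h), Set.iUnion_of_empty,
      (Subgroup.normalClosure_le_normal (N := ⊥) (Set.empty_subset _)).antisymm bot_le,
      AbsCusp.topologicalClosure_bot]
  · -- Rmk. 1.9.2: `Δ = 1` on both sides
    rw [GalSect.geom_eq_bot_of_aug_injective (haug X), GalSect.geom_eq_bot_of_aug_injective (haug Y),
      Subgroup.map_bot]
  · -- Thm. 1.3 (ii), points: `C_Π(Π) = Π`
    exact GalSect.thm_1_3_ii_points_of_decomp_eq_top _ (hdecomp U)
  · -- Thm. 1.3 (ii), cusps: none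
    exact GalSect.thm_1_3_ii_cusps_of_isEmpty _
  · -- Lem. 3.1 (i) ⇔ (iv)
    haveI : Nonempty (GalSect.pointDataOf M U (hclosed U)).Point := hpt U
    exact GalSect.lem_3_1_i_iff_iv_of_decomp_eq_top _ _ (hdecomp U) (halg U) (haug U)
  · -- Cor. 3.2
    haveI : Nonempty (GalSect.pointDataOf M U (hclosed U)).Point := hpt U
    haveI : Nonempty (GalSect.pointDataOf M V (hclosed V)).Point := hpt V
    exact GalSect.cor_3_2_of_decomp_eq_top _ _ (hdecomp U) (hdecomp V)
  · -- Prop. 1.6 (iii)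
    exact AbsCusp.prop_1_6_iii_of_injective_of_isEmpty _ (hinj US X h) (hsurj US X h) _
  · -- Prop. 2.2 (ii): one point with `D = Π`, no cusps
    refine AbsCusp.isSeparated_of_forall_eq_top _ ?_ ?_
    · rintro (x | c) (y | c)
      · rw [hone X x y]
      all_goals exact isEmptyElim c
    · rintro (x | c)
      · exact hdecomp X x
      · exact isEmptyElim c

/-! ### The witness interface: one curve over `ℚ_p`, `Π = G_{ℚ_p}`, one point `D = Π`, no cusps, `res = 𝟙` -/

/-- **JOINT NON-VACUOUS MODEL WITNESS for the ten `CurveModel`-relative named facts** (FACT-LIST rows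
F-0339, F-0340, F-0341, F-0236, F-0084, F-0083, F-0082, F-0045, F-0046, F-0044 — instance-form side).
For every prime `p` there is an interface `M : CurveModel` with closed decomposition data such that
(a) NON-VACUITY — some curve `X` of `M` is flagged proper AND scheme-like, has base field the MLF `ℚ_p`,
has a closed point, all its closed points carry the NF flag, has no cusps, is cofinite-open in itself with
SURJECTIVE restriction `Π_X ↠ Π_X`, its extension `Π_X ↠ G` admits a (continuous) section and a
characteristic tower — so every binder of every one of the ten rows fires at `X`; and (b) ALL TEN facts
hold at `M` simultaneously (Thm. 2.1 (i) for every value of its separatedness parameter, Lem. 3.1 /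
Cor. 3.2 for every value of their curve-predicate parameters).  The interface: ONE curve over `ℚ_p`,
`Π := G_{ℚ_p} ↠ G_{ℚ_p}` the identity (`Δ = 1`), no cusps, ONE closed point with `D := Π` flagged NF,
`res := 𝟙`.  HONEST LABEL: DEGENERATE junk data, not a model of any hyperbolic curve; a statement about
OUR typing (the hypothesis package consumers bind is jointly satisfiable), nothing about print.
[cite: MochizukiAbsTopIII2015, Prop 1.4 p.31] -/
theorem exists_facts_nonVacuous (p : ℕ) [Fact p.Prime] :
    ∃ (M : CurveModel.{0})
      (hclosed : ∀ (U : M.Curve) (x : M.Point U), IsClosed (M.decomp U x : Set (M.ext U).arith)),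
      (∃ (X : M.Curve) (hXX : M.IsCofiniteOpen X X),
          M.IsProper X ∧ M.IsScheme X ∧ IsMLF (M.base X) ∧ Nonempty (M.Point X) ∧
            (∀ x : M.Point X, M.IsNFPoint X x) ∧ IsEmpty (M.cusps X).Cusp ∧
            Function.Surjective (M.res hXX).arith ∧
            (∃ σ : (M.ext X).gal →ₜ* (M.ext X).arith, ∀ g, (M.ext X).aug (σ g) = g) ∧
            ∃ Δj : ℕ → Subgroup (M.ext X).geom, GalSect.IsCharacteristicTower (M.ext X) Δj) ∧
      M.Prop_1_4_i ∧ M.Prop_1_4_i' ∧ M.Prop_1_4_ii ∧ M.Rmk_1_9_2 ∧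
      GalSect.Thm_1_3_ii_model M hclosed ∧
      (∀ IsDefinedOverNF : M.Curve → Prop, GalSect.Lem_3_1_model M IsDefinedOverNF hclosed) ∧
      (∀ IsDefinedOverNF IsIsogenousToGenusZero : M.Curve → Prop,
          GalSect.Cor_3_2_model M IsDefinedOverNF IsIsogenousToGenusZero hclosed) ∧
      AbsCusp.Prop_1_6_iii_model M ∧
      (∀ IsSep : M.Curve → Prop, AbsCusp.Thm_2_1_i_model M IsSep hclosed) ∧
      AbsCusp.Thm_2_1_i_model_sep M hclosed ∧
      AbsCusp.Prop_2_2_ii_model M := by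
  -- the point extension `G_{ℚ_p} = G_{ℚ_p}` (identity augmentation, `Δ = 1`)
  let E₀ : FundamentalExtension.{0} :=
    ⟨absoluteGaloisGrp ℚ_[p], absoluteGaloisGrp ℚ_[p], ContinuousMonoidHom.id _, Function.surjective_id⟩
  -- no cusps
  let C₀ : E₀.CuspidalData :=
    { Cusp := PEmpty
      Dcusp := fun c => c.elim
      Icusp := fun c => c.elim
      Icusp_eq := fun c => c.elim
      isClosed_Dcusp := fun c => c.elim
      eq_of_conj := fun c => c.elim }
  -- one curve, one closed point with `D = Π`, `res = 𝟙`
  let M : CurveModel.{0} :=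
    { Curve := PUnit
      base := fun _ => ℚ_[p]
      ext := fun _ => E₀
      galIso := fun _ => Iso.refl _
      cusps := fun _ => C₀
      IsProper := fun _ => True
      IsScheme := fun _ => True
      genus := fun _ => 2
      FunctionField := fun _ => ℚ_[p]
      Point := fun _ => PUnit
      decomp := fun _ _ => ⊤
      IsNFCurve := fun _ => False
      IsNFPoint := fun _ _ => True
      IsNFRational := fun _ _ => False
      IsNFConstant := fun _ _ => False
      NFFunctionField := fun _ => ℚ_[p]
      IsStrictlyBelyiType := fun _ => False
      IsCofiniteOpen := fun _ _ => True
      res := fun _ => 𝟙 _ }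
  have hclosed : ∀ (U : M.Curve) (x : M.Point U), IsClosed (M.decomp U x : Set (M.ext U).arith) :=
    fun U x => by
      show IsClosed ((⊤ : Subgroup E₀.arith) : Set E₀.arith)
      rw [Subgroup.coe_top]
      exact isClosed_univ
  have haug : ∀ U : M.Curve, Function.Injective (M.ext U).aug := fun _ => Function.injective_id
  have hcusp : ∀ U : M.Curve, IsEmpty (M.cusps U).Cusp := fun _ => ⟨fun c => PEmpty.elim c⟩
  refine ⟨M, hclosed, ⟨PUnit.unit, trivial, trivial, trivial, isMLF_padic p, ⟨PUnit.unit⟩,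
    fun _ => trivial, hcusp _, Function.surjective_id, ⟨ContinuousMonoidHom.id _, fun _ => rfl⟩,
    fun _ => ⊥, GalSect.isCharacteristicTower_bot_of_aug_injective (haug PUnit.unit)⟩, ?_⟩
  exact facts_of_decomp_eq_top M hclosed (fun _ _ => rfl) (fun _ => ⟨PUnit.unit⟩)
    (fun _ _ _ => rfl) (fun _ _ => trivial) hcusp haug (fun _ _ _ => Function.injective_id)
    (fun _ _ _ => Function.surjective_id) (fun _ _ _ => Function.bijective_id)

end AbsTopIII.CurveModel

end Literature.AnabelianGeometry.AbsoluteAnabelian
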